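import Literature.Probability.LatticeModels.HSLangevinPairChain
import HarnessLib

/-!
# HS–Langevin pair chain, II: torus block noise, block read-outs, rotated cells

Topic `Literature/Probability/LatticeModels`; second half of definition request
`defn-HSLangevinPairChain` (route CriticalPhenomena/Ising3DConformalLimit `SynchronousCoupling`).
The core dynamics (`couplingMatrix`/`Mop`/`Mfree`, `drift`, `eulerStep`, `pairStep`, `noise`,
`IsStationaryPair`) is `HSLangevinPairChain.lean`; here are the lattice-specific pieces the two
cruxes read the common noise and the fields through (namespace
`Literature.Probability.LatticeModels.HSLangevin`).

* DILATION PAIR (crux `DilationJoinings`, card K1): fine torus `(ℤ/pLℤ)^d`, coarse torus `(ℤ/Lℤ)^d`,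
  `blockProj p L` (coordinatewise `x_i ↦ ⌊x_i/p⌋`), `torusCell p L u` (the `p^d` fine sites above
  `u`), `blockNoise p L ξ = p^{-d/2} ∑_{cell} ξ` (a standard Gaussian vector on the coarse torus when
  `ξ` is one on the fine torus; also as a matrix `blockNoiseMatrix`, so that the coarse noise factor
  is `Q₂ * blockNoiseMatrix p L`), and the block read-outs `tblock B M ψ = ∑_{x∈B} tanh((Mψ)_x) =
  E[∑_{x∈B} σ_x | ψ]`, `tanhBlock p L M ψ u` (over the `p`-cell above `u`).
* ROTATION PAIR (crux `RotationJoining`, card K2): fields on a box `Λ ⊆ ℤ^d` (`Mfree`), axis cubes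
  `axisCell n u = ℤ^d ∩ n(u+[0,1)^d)` and `axisTanhBlock`, rotated cubes
  `InRotCell A s n u x ↔ A x ∈ s n (u+[0,1)^d)` (the cube `n(u+[0,1)^d)` pulled back by the rational
  rotation `A/s`) and `rotTanhBlock` — Kozma's commensurate-rotation comparison (Acta Math. 199
  (2007) §6.1, there with the `arctan(3/4)` rotation about an axis) read through the Kac–Siegert
  field; the route's numerator `rotNumerator = ((2,2,-1),(-1,2,2),(2,-1,2))` with `AᵀA = AAᵀ = 9·1`,
  `det A = 27` (so `A/3 ∈ SO(3)`, and `∉ B₃` since no entry is `0, ±1`); and the cell overlaps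
  `cellOverlap T x y = vol(T(x+[0,1)^d) ∩ (y+[0,1)^d))`, the covariance of the white-noise charges of
  a rotated and an axis unit cell, which a Gram noise factor `B` (`B Bᵀ = overlaps`) realises from
  one standard Gaussian vector; `pairCell` / `cellGram` package the joint (rotated ⊕ axis) cell family and its Gram
  matrix `vol(cell a ∩ cell b)` (so the factor condition reads `B Bᵀ = cellGram T` on the window).

No named facts (unproved `Prop` definitions) are introduced in this file.
-/

noncomputable section

open MeasureTheory ProbabilityTheory Matrix Finset

namespace Literature.Probability.LatticeModels

namespace HSLangevin

/-! ### Torus block noise and cell overlaps -/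

section Noise

variable {d : ℕ}

/-- The `p`-block projection of the fine torus `(ℤ/pLℤ)^d` onto the coarse torus `(ℤ/Lℤ)^d`:
coordinatewise `x_i ↦ ⌊x_i / p⌋` on representatives `x_i ∈ {0, …, pL-1}`. [folklore] -/
def blockProj (p L : ℕ) (x : TorusSite d (p * L)) : TorusSite d L :=
  fun i => (((x i).val / p : ℕ) : ZMod L)

/-- The `p`-cell of the fine torus above the coarse site `u`. [folklore] -/
def torusCell (p L : ℕ) [NeZero (p * L)] (u : TorusSite d L) : Finset (TorusSite d (p * L)) :=
  univ.filter fun x => blockProj p L x = u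

/-- BLOCK NOISE: the normalised `p`-cell sums `(blockNoise p L ξ)_u = p^{-d/2} ∑_{x ∈ cell(u)} ξ_x`
of a fine-torus noise draw; for `ξ ∼ noise` these are again i.i.d. `N(0,1)` over coarse sites (the
cells are disjoint with `p^d` points), which is how the dilation pair reads ONE noise at two meshes
(card kac-siegert-cross-mesh-synchronisation, K1). [folklore] -/
def blockNoise (p L : ℕ) [NeZero (p * L)] (ξ : TorusSite d (p * L) → ℝ) : TorusSite d L → ℝ :=
  fun u => (Real.sqrt ((p : ℝ) ^ d))⁻¹ * ∑ x ∈ torusCell p L u, ξ x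

/-- The block-noise map as a matrix (so that it composes with noise factors). [folklore] -/
def blockNoiseMatrix (p L : ℕ) : Matrix (TorusSite d L) (TorusSite d (p * L)) ℝ :=
  Matrix.of fun u x => if blockProj p L x = u then (Real.sqrt ((p : ℝ) ^ d))⁻¹ else 0

/-- `blockNoiseMatrix` acts as `blockNoise`. [folklore] -/
theorem blockNoiseMatrix_mulVec (p L : ℕ) [NeZero (p * L)] (ξ : TorusSite d (p * L) → ℝ) :
    blockNoiseMatrix p L *ᵥ ξ = blockNoise (d := d) p L ξ := by
  funext u
  simp only [blockNoiseMatrix, blockNoise, torusCell, mulVec, dotProduct, Matrix.of_apply,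
    ite_mul, zero_mul, Finset.sum_ite, Finset.sum_const_zero, add_zero, Finset.mul_sum]

/-- `blockNoise` is a linear, hence measurable, map of the noise. [folklore] -/
theorem measurable_blockNoise (p L : ℕ) [NeZero (p * L)] [NeZero L] :
    Measurable (blockNoise (d := d) p L) := by
  refine measurable_pi_lambda _ fun u => ?_
  exact (Finset.measurable_sum _ fun x _ => measurable_pi_apply x).const_mul _

/-- The half-open unit cube `x + [0,1)^d ⊆ ℝ^d` attached to the lattice point `x ∈ ℤ^d`. [folklore] -/
def unitCube (x : Site d) : Set (Fin d → ℝ) :=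
  Set.pi Set.univ fun i => Set.Ico (x i : ℝ) (x i + 1)

/-- The CELL OVERLAP `cellOverlap T x y = vol(T(x + [0,1)^d) ∩ (y + [0,1)^d))`: the covariance
`E[W(T(x+[0,1)^d)) W(y+[0,1)^d)]` of the white-noise charges of a rotated and an axis unit cell, i.e.
the Gram matrix a noise factor `B` of the rotation pair must reproduce (`B Bᵀ = overlaps`; card
kac-siegert-cross-mesh-synchronisation, K2). [folklore] -/
def cellOverlap (T : Matrix (Fin d) (Fin d) ℝ) (x y : Site d) : ℝ :=
  (volume ((fun v => T *ᵥ v) '' unitCube x ∩ unitCube y)).toReal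

/-- The joint family of cells read by the rotation pair: rotated unit cells `T(x + [0,1)^d)` for the
first copy (index `Sum.inl x`) and axis unit cells `y + [0,1)^d` for the second (`Sum.inr y`). [folklore] -/
def pairCell (T : Matrix (Fin d) (Fin d) ℝ) : Site d ⊕ Site d → Set (Fin d → ℝ)
  | Sum.inl x => (fun v => T *ᵥ v) '' unitCube x
  | Sum.inr y => unitCube y

/-- The GRAM (covariance) MATRIX of the white-noise charges of the joint cell family,
`cellGram T a b = vol(cell a ∩ cell b)` (`= E[W(cell a) W(cell b)]` for a white noise `W` on `ℝ^d`):
a noise factor `B : Matrix (Λ₁ ⊕ Λ₂) ι ℝ` for the rotation pair on finite windows is any matrix with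
`(B Bᵀ) a b = cellGram T a b`; its `inl/inr` block is `cellOverlap`. [folklore] -/
def cellGram (T : Matrix (Fin d) (Fin d) ℝ) (a b : Site d ⊕ Site d) : ℝ :=
  (volume (pairCell T a ∩ pairCell T b)).toReal

/-- The off-diagonal block of the Gram matrix is the cell overlap. [folklore] -/
@[simp] theorem cellGram_inl_inr (T : Matrix (Fin d) (Fin d) ℝ) (x y : Site d) :
    cellGram T (Sum.inl x) (Sum.inr y) = cellOverlap T x y := rfl

/-- The Gram matrix is symmetric. [folklore] -/
theorem cellGram_comm (T : Matrix (Fin d) (Fin d) ℝ) (a b : Site d ⊕ Site d) :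
    cellGram T a b = cellGram T b a := by
  rw [cellGram, cellGram, Set.inter_comm]

end Noise

/-! ### Block read-outs: torus cells, axis cubes, rotated cubes -/

section Blocks

variable {V : Type*} [Fintype V] {d : ℕ}

/-- The block read-out `tblock B M ψ = ∑_{x ∈ B} tanh((Mψ)_x) = E[∑_{x ∈ B} σ_x | ψ]`, the
conditional mean of the block spin of `B` given the field. [folklore] -/
def tblock (B : Finset V) (M : Matrix V V ℝ) (ψ : V → ℝ) : ℝ :=
  ∑ x ∈ B, tanhField M ψ x

/-- `|tblock B M ψ| ≤ |B|` since `|tanh| ≤ 1`. [folklore] -/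
theorem abs_tblock_le (B : Finset V) (M : Matrix V V ℝ) (ψ : V → ℝ) :
    |tblock B M ψ| ≤ B.card := by
  unfold tblock tanhField
  calc |∑ x ∈ B, Real.tanh ((M *ᵥ ψ) x)| ≤ ∑ x ∈ B, |Real.tanh ((M *ᵥ ψ) x)| :=
        Finset.abs_sum_le_sum_abs _ _
    _ ≤ ∑ _x ∈ B, (1 : ℝ) := Finset.sum_le_sum fun x _ => (Real.abs_tanh_lt_one _).le
    _ = B.card := by simp

/-- Torus block read-out: `tanhBlock p L M ψ u = ∑_{x ∈ cell_p(u)} tanh((Mψ)_x)` over the `p`-cell of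
the fine torus `(ℤ/pLℤ)^d` above the coarse site `u ∈ (ℤ/Lℤ)^d`. [folklore] -/
def tanhBlock (p L : ℕ) [NeZero (p * L)] (M : Matrix (TorusSite d (p * L)) (TorusSite d (p * L)) ℝ)
    (ψ : TorusSite d (p * L) → ℝ) (u : TorusSite d L) : ℝ :=
  tblock (torusCell p L u) M ψ

/-- The axis cube of side `n` at block index `u`: `{x ∈ ℤ^d | n u_i ≤ x_i < n u_i + n}`, i.e. the
lattice points of `n(u + [0,1)^d)` (as in `DilationJoinings` / `RotationJoining`). [folklore] -/
def axisCell (n : ℕ) (u : Fin d → ℤ) : Finset (Site d) :=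
  Fintype.piFinset fun i => Finset.Ico ((n : ℤ) * u i) ((n : ℤ) * u i + n)

/-- Membership in the rotated cube: `InRotCell A s n u x ↔ ∀ i, s n u_i ≤ (A x)_i < s n (u_i + 1)`,
i.e. `(A/s) x ∈ n(u + [0,1)^d)`: `x` is a lattice point of the cube `n(u+[0,1)^d)` rotated by
`(A/s)⁻¹` (for `A = rotNumerator`, `s = 3` this is the cell of `RotationJoining`). The device —
compare the model on `ℤ^d` with the model on a COMMENSURATE rotated lattice `(A/s)ℤ^d ⊇ sℤ^d`-type
sublattice — is Kozma's (2007, §6.1, with the rotation by `arctan(3/4)` about the `z`-axis spanned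
by `(4,3,0),(3,-4,0),(0,0,5)`, commensurate with `25ℤ³`). [cite: Kozma2007, §6.1] -/
def InRotCell (A : Matrix (Fin d) (Fin d) ℤ) (s n : ℕ) (u : Fin d → ℤ) (x : Site d) : Prop :=
  ∀ i, (s : ℤ) * n * u i ≤ (A *ᵥ x) i ∧ (A *ᵥ x) i < (s : ℤ) * n * (u i + 1)

/-- Membership in a rotated cube is decidable (finitely many integer inequalities). [folklore] -/
instance InRotCell.instDecidable (A : Matrix (Fin d) (Fin d) ℤ) (s n : ℕ) (u : Fin d → ℤ) (x : Site d) :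
    Decidable (InRotCell A s n u x) := by
  unfold InRotCell; infer_instance

/-- Axis block read-out on a box field `ψ : Λ → ℝ`: the sum of `tanh((Mψ)_x)` over the sites of `Λ`
in the axis cube `n(u + [0,1)^d)`. [folklore] -/
def axisTanhBlock (Λ : Finset (Site d)) (n : ℕ) (M : Matrix Λ Λ ℝ) (ψ : Λ → ℝ) (u : Fin d → ℤ) :
    ℝ :=
  tblock (univ.filter fun x : Λ => (x : Site d) ∈ axisCell n u) M ψ

/-- Rotated block read-out on a box field: the sum of `tanh((Mψ)_x)` over the sites `x ∈ Λ` with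
`A x ∈ s n (u + [0,1)^d)` (Kozma's commensurate-rotation comparison, 2007 §6.1, read through the
Kac–Siegert field). [cite: Kozma2007, §6.1] -/
def rotTanhBlock (Λ : Finset (Site d)) (A : Matrix (Fin d) (Fin d) ℤ) (s n : ℕ) (M : Matrix Λ Λ ℝ)
    (ψ : Λ → ℝ) (u : Fin d → ℤ) : ℝ :=
  tblock (univ.filter fun x : Λ => InRotCell A s n u (x : Site d)) M ψ

/-- The numerator `A = ((2,2,-1),(-1,2,2),(2,-1,2))` of the rational rotation `T = A/3` fixed by
route SynchronousCoupling (crux `RotationJoining`): `AᵀA = 9·1` and `det A = 27`, so `T ∈ SO(3)`;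
no entry of `T` is `0` or `±1`, so `T` lies outside the hyperoctahedral group `B₃`; and
`A(3ℤ³) ⊆ 3ℤ³`-commensurability (`9ℤ³ = AᵀA ℤ³ ⊆ Aℤ³`) is what Kozma's device needs (Kozma 2007
§6.1 uses instead the `arctan(3/4)` rotation about an axis). The matrix itself is the route's
choice. [folklore] -/
def rotNumerator : Matrix (Fin 3) (Fin 3) ℤ :=
  !![2, 2, -1; -1, 2, 2; 2, -1, 2]

/-- `AᵀA = 9·1`, i.e. `A/3` is orthogonal. [folklore] -/
theorem rotNumerator_transpose_mul_self : rotNumeratorᵀ * rotNumerator = (9 : ℤ) • 1 := by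
  decide

/-- `A Aᵀ = 9·1` as well. [folklore] -/
theorem rotNumerator_mul_transpose_self : rotNumerator * rotNumeratorᵀ = (9 : ℤ) • 1 := by
  decide

/-- `det A = 27 > 0`, so `A/3 ∈ SO(3)`. [folklore] -/
theorem rotNumerator_det : rotNumerator.det = 27 := by
  decide

end Blocks

end HSLangevin

end Literature.Probability.LatticeModels
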